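import Literature.Algebra.Homology.OrderedCechSystemLTensor
import Literature.Algebra.Homology.OrderedCechPieces
import Literature.Algebra.Homology.FiniteFreeResolution
import Literature.Algebra.Homology.PerfectOfPseudoCoherent
import Mathlib.RingTheory.Ideal.AssociatedPrime.Finiteness
import Mathlib.Algebra.Homology.HomologySequence
import HarnessLib

/-!
# Dévissage: the ordered Čech complex of a flat system over a noetherian ring is perfect as soon as its
# strata `A⧸𝔭 ⊗ M` have finitely generated cohomology (Görtz–Wedhorn II, Thm. 23.133 (I)–(III); EGA III 6.10.5)

Let `A` be a noetherian ring and `M : Finset ι ⥤ ModuleCat A` a system of FLAT `A`-modules on a finite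
index set (`Literature/Algebra/Homology/OrderedCechSystem`, `…LTensor`; in the application `M s = Γ(W_s, 𝓛)` for an
affine cover of `P ×_K Spec A` flat over `A`). If for every prime `𝔭` the Čech cohomology of the stratum
`A⧸𝔭 ⊗_A M` is finitely generated, then:

* `OrderedCech.module_finite_homology_lTensorSys_of_strata` — `Hⁱ(Č(N ⊗ M))` is finitely generated for
  EVERY finitely generated `N` (dévissage along a prime filtration of `N`: Mathlib
  `IsNoetherianRing.induction_on_isQuotientEquivQuotientPrime`; the exact triples give short exact
  sequences of complexes by flatness, `OrderedCech.shortExact_lTensorSysSC`, and the long exact sequence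
  with `OrderedCech.moduleFinite_mid_of_exact`; Görtz–Wedhorn I, Lemma 12.63 / EGA III 3.1.2 pattern);
* `OrderedCech.module_finite_homology_of_strata` — `Hⁱ(Č(M))` is finitely generated (`N = A`);
* **`OrderedCech.exists_strictlyPerfect_quasiIso_of_strata`** — there is a complex `P` of finitely
  generated projective `A`-modules in degrees `[0, r]` (`#ι ≤ r + 1`) with a quasi-isomorphism
  `P → Č(M)` (`exists_finiteFree_quasiIso_of_finite_homology` + `exists_strictlyPerfect_quasiIso_of_flat`,
  Görtz–Wedhorn II, Cor. 22.62 + Lemma 21.173 / Mumford, *Abelian Varieties*, §5, Lemma 1).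

Everything is proved; no named facts. Mathlib searched (pin):
`IsNoetherianRing.induction_on_isQuotientEquivQuotientPrime`, `ShortComplex.ShortExact.homology_exact₂`,
`ModuleCat.isZero_of_subsingleton`, `HomologicalComplex.exactAt_iff_isZero_homology`, `Iso.toLinearEquiv`
(used).

## References

* U. Görtz, T. Wedhorn, *Algebraic Geometry II: Cohomology of Schemes* (2023): Thm. 23.133 with proof,
  Steps (I)–(III) (pp. 354–355); Cor. 22.62 (p. 262); Lemma 21.173 (p. 224). [GortzWedhorn2023]
* U. Görtz, T. Wedhorn, *Algebraic Geometry I: Schemes*, 2nd ed. (2020), Lemma 12.63. [GortzWedhorn2020]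
* A. Grothendieck, EGA III₂ (1963), 6.10.5; EGA III₁ (1961), 3.1.2. [EGA3]
* D. Mumford, *Abelian Varieties* (1970), §5, Lemmas 1–2. [MumfordAV1970]
-/

universe u

open CategoryTheory TensorProduct

set_option backward.isDefEq.respectTransparency false

noncomputable section

namespace Literature.Algebra.Homology

namespace OrderedCech

variable {ι : Type} [LinearOrder ι] [Fintype ι] {A : Type u} [CommRing A]
variable (M : Finset ι ⥤ ModuleCat.{u} A)

/-- Finite generation of homology transfers along an isomorphism of complexes. [folklore] [cite: GortzWedhorn2023, Thm. 23.133 proof (pp. 354–355)] -/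
theorem module_finite_homology_of_iso {K L : CochainComplex (ModuleCat.{u} A) ℤ} (e : K ≅ L) (i : ℤ)
    (h : Module.Finite A (K.homology i)) : Module.Finite A (L.homology i) :=
  haveI := h
  Module.Finite.equiv (M := K.homology i) ((HomologicalComplex.homologyFunctor _ _ i).mapIso e).toLinearEquiv

/-- A complex of zero modules has (finitely generated, indeed) zero homology. [folklore] [cite: GortzWedhorn2023, Thm. 23.133 proof (pp. 354–355)] -/
theorem module_finite_homology_of_subsingleton (K : CochainComplex (ModuleCat.{u} A) ℤ)
    (h : ∀ n, Subsingleton (K.X n)) (i : ℤ) : Module.Finite A (K.homology i) := by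
  have hz : Limits.IsZero (K.homology i) := by
    rw [← HomologicalComplex.exactAt_iff_isZero_homology]
    haveI : Subsingleton ((K.sc i).X₂) := h i
    exact ShortComplex.exact_of_isZero_X₂ _ (ModuleCat.isZero_of_subsingleton _)
  haveI : Subsingleton (K.homology i) := ModuleCat.subsingleton_of_isZero hz
  infer_instance

/-- **The strata hypothesis**: for every prime `𝔭` of `A`, the ordered Čech cohomology of the system
`A⧸𝔭 ⊗_A M` is finitely generated (in the application: the finiteness theorem for the line bundle
restricted to the INTEGRAL closed subscheme `P ×_K Spec(A⧸𝔭)`). [folklore] [cite: GortzWedhorn2023, Thm. 23.133 proof (pp. 354–355)] -/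
def StrataFinite : Prop :=
  ∀ (𝔭 : PrimeSpectrum A) (i : ℤ), Module.Finite A ((sysComplex (lTensorSys (A ⧸ 𝔭.asIdeal) M)).homology i)

variable [IsNoetherianRing A]

/-- **Dévissage** (Görtz–Wedhorn II, Thm. 23.133, Step (I) / EGA III 6.10.5 pattern): for a system of
FLAT modules over a noetherian ring whose prime strata have finitely generated Čech cohomology,
`Hⁱ(Č(N ⊗ M))` is finitely generated for every finitely generated `N` — induction along a prime
filtration `0 = N₀ ⊆ ⋯ ⊆ N_k = N`, `N_{j+1}/N_j ≅ A⧸𝔭_j`.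
[cite: GortzWedhorn2023, Thm. 23.133, proof, Step (I) (p. 354)] -/
theorem module_finite_homology_lTensorSys_of_strata
    (hflat : ∀ s : Finset ι, s.Nonempty → Module.Flat A (M.obj s)) (hstrata : StrataFinite M)
    (N : Type u) [AddCommGroup N] [Module A N] [Module.Finite A N] (i : ℤ) :
    Module.Finite A ((sysComplex (lTensorSys N M)).homology i) := by
  revert i
  refine IsNoetherianRing.induction_on_isQuotientEquivQuotientPrime (A := A) (M := N) inferInstance
    (motive := fun N _ _ _ => ∀ i : ℤ, Module.Finite A ((sysComplex (lTensorSys N M)).homology i))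
    ?_ ?_ ?_
  · -- `N = 0`
    intro N _ _ _ _ i
    refine module_finite_homology_of_subsingleton _ (fun n => ?_) i
    change Subsingleton (∀ σ : Simplex ι n, N ⊗[A] M.obj σ.1)
    infer_instance
  · -- `N ≅ A⧸𝔭`
    intro N _ _ _ 𝔭 e i
    exact module_finite_homology_of_iso (sysComplexMapIso (lTensorSysIso M e).symm) i (hstrata 𝔭 i)
  · -- exact triples
    intro N₁ _ _ _ N₂ _ _ _ N₃ _ _ _ f g hf hg hfg h₁ h₃ i
    have hS := shortExact_lTensorSysSC M hflat f g hf hg hfg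
    exact @moduleFinite_mid_of_exact A _ _ _ (hS.homology_exact₂ i) (h₁ i) (h₃ i)

/-- **`Hⁱ(Č(M))` is finitely generated** for a system of flat modules over a noetherian ring with finite
strata (`N = A` in the dévissage). [cite: GortzWedhorn2023, Thm. 23.133, proof, Step (I) (p. 354)] -/
theorem module_finite_homology_of_strata
    (hflat : ∀ s : Finset ι, s.Nonempty → Module.Flat A (M.obj s)) (hstrata : StrataFinite M) (i : ℤ) :
    Module.Finite A ((sysComplex M).homology i) :=
  module_finite_homology_of_iso (sysComplexMapIso (lTensorSysIsoSelf M)) i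
    (module_finite_homology_lTensorSys_of_strata M hflat hstrata A i)

/-- **The ordered Čech complex of a flat system with finite strata is (strictly) perfect**: a complex
`P` of finitely generated projective `A`-modules in degrees `[0, r]` (`#ι ≤ r + 1`) with a
quasi-isomorphism `P → Č(M)` (finite cohomology over a noetherian ring ⇒ finite free resolution,
Görtz–Wedhorn II, Cor. 22.62; flat terms in `[0, r]` ⇒ strictly perfect there, Lemma 21.173 /
Mumford §5 Lemma 1). [cite: GortzWedhorn2023, Thm. 23.133, proof, Steps (I)–(III) (pp. 354–355)] -/
theorem exists_strictlyPerfect_quasiIso_of_strata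
    (hflat : ∀ s : Finset ι, s.Nonempty → Module.Flat A (M.obj s)) (hstrata : StrataFinite M)
    (r : ℕ) (hr : (Fintype.card ι : ℤ) ≤ r + 1) :
    ∃ (P : CochainComplex (ModuleCat.{u} A) ℤ) (ψ : P ⟶ sysComplex M), QuasiIso ψ ∧
      P.IsStrictlyGE 0 ∧ P.IsStrictlyLE (r : ℤ) ∧
      ∀ n, Module.Finite A (P.X n) ∧ Module.Projective A (P.X n) := by
  haveI : (sysComplex M).IsStrictlyLE (r : ℤ) := isStrictlyLE_sysComplex_of_card_le M r hr
  haveI : (sysComplex M).IsStrictlyGE 0 := isStrictlyGE_sysComplex M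
  obtain ⟨F, φ, hφ, hFle, hF⟩ := exists_finiteFree_quasiIso_of_finite_homology (sysComplex M) (r : ℤ)
    (module_finite_homology_of_strata M hflat hstrata)
  haveI := hφ
  haveI := hFle
  exact exists_strictlyPerfect_quasiIso_of_flat (sysComplex M) r (flat_sysComplex_X M hflat) F (r : ℤ)
    (fun n => ⟨(hF n).1, by haveI := (hF n).2; exact Module.Projective.of_free⟩) φ

end OrderedCech

end Literature.Algebra.Homology

end
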